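import Summits.KontsevichZagierPeriods.KontsevichZagierPeriods.Theses.ValuedFieldSpecialisation

/-!
# Route ValuedFieldSpecialisation — support item `FibredRelationsLeRelations`

Fibred chains are chains: the subgroup of `KZ.FormalRep` generated by the fibred move generators
(all instances of domain / integrand additivity, the changes of variables preserving the parameter
coordinate `z 0`, and the Newton–Leibniz moves over a base of dimension `≥ 1`) is contained in
`KZ.relations`. The generator set inlined in the route declaration is, verbatim,
`KZ.fibredGenerators` of `Literature/NumberTheory/Transcendental/KZFibredRelations.lean`, so the
item is definitionally `KZ.fibredRelations_le_relations` (the term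
`KZ.fibredRelations_le_relations` elaborates at the route type); we give the direct proof
(`AddSubgroup.closure_le` and the four generatorwise inclusions) so that the file does not depend on
that definitional coincidence.
-/

namespace Summit.KontsevichZagierPeriods.ValuedFieldSpecialisation

open Literature.NumberTheory.Transcendental

/-- **Fibred chains are chains** (route ValuedFieldSpecialisation, support item
`FibredRelationsLeRelations`): the closure of the fibred move generators is `≤ KZ.relations`.
Proof: `AddSubgroup.closure_le`; a domain/integrand additivity instance is a KZ generator, a fibred
change of variables is a change of variables (drop the clause `Φ x 0 = x 0`), and a fibred
Newton–Leibniz move is a Newton–Leibniz move (its first conjunct). -/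
theorem fibredRelationsLeRelations_proof :
    Summit.KontsevichZagierPeriods.KontsevichZagierPeriods.Theses.ValuedFieldSpecialisation.FibredRelationsLeRelations := by
  unfold Summit.KontsevichZagierPeriods.KontsevichZagierPeriods.Theses.ValuedFieldSpecialisation.FibredRelationsLeRelations
  refine (AddSubgroup.closure_le _).mpr ?_
  rintro c (((hc | hc) | hc) | hc)
  · exact AddSubgroup.subset_closure (Or.inl (Or.inl (Or.inl hc)))
  · exact AddSubgroup.subset_closure (Or.inl (Or.inl (Or.inr hc)))
  · obtain ⟨n, r, r', Φ, Φ', hΦ, hΦ', hinj, hdom, hf, -, rfl⟩ := hc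
    exact AddSubgroup.subset_closure
      (Or.inl (Or.inr ⟨n + 1, r, r', Φ, Φ', hΦ, hΦ', hinj, hdom, hf, rfl⟩))
  · exact AddSubgroup.subset_closure (Or.inr hc.1)

end Summit.KontsevichZagierPeriods.ValuedFieldSpecialisation
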